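/-
Copyright: the b2b-balaban T⁴-continuum CRUX team, row NE7b leaf lineage `t4-ne7b-formalise-leaf-06` (gen 157). Project licence.
-/
import Summits.QuantumFields.BalabanUV.T4Continuum.Spine.NE7b.HardStepChartRadius
import Summits.QuantumFields.BalabanUV.T4Continuum.Spine.NE7b.ChartLetterSandwich

/-!
# THE ONE-SHOT CHART IN THE ENERGY CURRENCY: for a fine Hessian sandwiched `γ₀‖v‖² ≤ V″(δ₀)vv ≤ γ₁‖v‖²` and a blocking read in its
# quotient norm (an isometric section), `…HardStepChartRadius`'s constrained-critical branch exists on the chart ball of radius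
# `((√(γ₁∕γ₀) + γ₀⁻¹)⁻¹ − c)·r` with Lipschitz constant `((√(γ₁∕γ₀) + γ₀⁻¹)⁻¹ − c)⁻¹` — constants of the SANDWICH only; read for a
# COMPOSITE blocking this is the `k`-step chart in one shot, uniform in `k` (row NE7b, node U5c; assembly of leaf-04's HSCR and this
# lineage's CLSW BY NAME; [folklore])

Cell `pub-balaban`, sub-cell `t4`, spine estimate NE7b (`T4WeightBudget.RelWeightBound`; the cell's OWN estimate — NOT PRINTED in
[Bałaban 1983–89], NOT PROVED).  Crux-route work under `Spine/NE7b/` by a row leaf (`t4-ne7b-formalise-leaf-06` gen 157) in the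
hard-step cell under FREEZE (0)'s crux-prover clause; NOTHING of Bałaban's is named as a Lean object, valued or asserted; no
`T4Continuum/Support` leaf typed; no `def`; zero `sorry`.  ASSEMBLY ONLY, BY NAME: leaf-04's `…HardStepChartRadius` (HSCR
`exists_criticalBranch_chart_ker`: the branch from the two displayed chart letters `T`, `‖T⁻¹y‖ ≤ N‖y‖` and the modulus `c < N⁻¹`) and
this lineage's `…ChartLetterSandwich` (CLSW `exists_augHessian_equiv_of_sandwich_iso_nnreal`: those two letters from the sandwich with
`N = √(γ₁∕γ₀) + γ₀⁻¹`).  Met BY SHAPE: leaf-03's `…HardStepSemigroupTower` §5 `tower_branch_eq_oneShot` (the one-shot branch of the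
composite blocking EQUALS the iterated branch on the tower's charts — so this file's radius is the tower's), this lineage's HSRF §4
(the same constants at the next scale, step by step), the pricing desk's [NE7bREF-G99-WORD-HSRF] («(d2) = one-shot chart in energy
currency … uniform, typed today modulo landing order»).

WHY.  The per-step radius recursion `r_{k+1} = (N_k⁻¹ − c_k)·r_k` contracts geometrically in every currency (the desk's located (i));
print never composes charts — its scale-`k` background field is the constrained minimiser over the COMPOSITE constraint, ONE chart.
In the reference form's energy currency the composite blocking's quotient norm makes its critical section an isometry and the fine
Hessian's sandwich constants `(γ₀, γ₁)` are all that enter the chart constant (CLSW), so HSCR's one-shot chart has a radius fraction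
`(√(γ₁∕γ₀) + γ₀⁻¹)⁻¹ − c` that does not depend on the number of steps folded into the blocking.  What remains by value is the
modulus `c` (the third-derivative letter times the radius, in the same currency) and the junction of the energy ball with print's
intensive regions (the desk's (ii)) — not here.

WHAT IS PROVED ([folklore] assembly; `E` a real Hilbert space, nontrivial; `F` real normed; `V : E → ℝ`, `V″ : E → (E →L E →L ℝ)`,
`δ₀ : E`, `D : E →L F`, `S : F →L E`):
* **`oneShotBranch_of_sandwich`** — `V″(δ₀)` symmetric with `γ₀‖v‖² ≤ V″(δ₀)vv ≤ γ₁‖v‖²` (`0 < γ₀`, `0 ≤ γ₁`); `S` a section of `D`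
  with `‖Sk‖ = ‖k‖`; `N : ℝ≥0` with `√(γ₁∕γ₀) + γ₀⁻¹ ≤ N`; `c < N⁻¹`; on `closedBall δ₀ r` (`0 ≤ r`): `HasFDerivAt (fderiv V) (V″x) x` and
  `‖V″x − V″δ₀‖ ≤ c`; kernel criticality `DV(δ₀)|_{ker D} = 0` ⟹ HSCR's conclusion VERBATIM: `∃ σ`, `σ(Dδ₀) = δ₀`, on
  `closedBall (Dδ₀) ((N⁻¹ − c)·r)` the values lie in the fibre ball, `D ∘ σ = id`, constrained criticality, `σ` is
  `(N⁻¹ − c)⁻¹`-Lipschitz there, and uniqueness among constrained-critical points of the fibre ball.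
* `oneShotBranch_of_sandwich'` — the same with `N := √(γ₁∕γ₀) + γ₀⁻¹` itself (as an `ℝ≥0` via `Real.toNNReal`; hypothesis
  `c < (√(γ₁∕γ₀) + γ₀⁻¹)⁻¹` on the reals).
* §2 toy.

NOT HERE (honest): the identification of `D` with a composite of print's averagings and of `‖·‖` with the reference energy norm
(the currency junction; (A3) ∕ (A1c), NC-NE7b-α UNRULED); the modulus `c` by value; the derivative letters of the branch (HSBD ∕ HSBDS ∕
PPT apply verbatim to this `T`, `N`); anything of Bałaban's.  BY-NAME EFFECT ON THE WALL: NONE.  NE7b NOT PRINTED ∕ NOT PROVED; spine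
PROVED 0∕9; rung (B)+1 on a FINITE torus — NOT infinite volume, NOT the mass gap, NOT Clay.  HONEST DEPENDENCY: continuum YM on T⁴ ⇐
BetaPertH ∧ nine spine estimates (0∕9 proved); BetaPertH ⇐ (D1) ∧ (D4) ∧ CAP+tail; G-an2-4 gates asym, D1 and NE2∕3∕4.
-/

set_option autoImplicit false

noncomputable section

namespace Summit.QuantumFields.BalabanUV.T4Continuum.NE7b.OneShotChartEnergy

open Set Metric
open scoped NNReal
open Summit.QuantumFields.BalabanUV.T4Continuum.NE7b

variable {E F : Type*} [NormedAddCommGroup E] [InnerProductSpace ℝ E] [CompleteSpace E] [Nontrivial E]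
  [NormedAddCommGroup F] [NormedSpace ℝ F]

/-- **THE ONE-SHOT CHART FROM THE SANDWICH.**  `V″(δ₀)` symmetric, `γ₀‖v‖² ≤ V″(δ₀)vv ≤ γ₁‖v‖²` (`0 < γ₀`, `0 ≤ γ₁`), `S` an
ISOMETRIC section of `D` (`F` in the quotient ∕ energy norm), `√(γ₁∕γ₀) + γ₀⁻¹ ≤ N`, `c < N⁻¹`, HSCR's window letters on `closedBall δ₀ r`
and kernel criticality at `δ₀` ⟹ HSCR `exists_criticalBranch_chart_ker`'s conclusion with THIS `N` — CLSW supplies `T` and `hN`.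
[folklore] -/
theorem oneShotBranch_of_sandwich (D : E →L[ℝ] F) {V : E → ℝ} {V'' : E → E →L[ℝ] E →L[ℝ] ℝ} {δ₀ : E}
    (S : F →L[ℝ] E) (hS : ∀ k, D (S k) = k) (hSiso : ∀ k, ‖S k‖ = ‖k‖)
    (hsymm : ∀ u v, V'' δ₀ u v = V'' δ₀ v u) {γ₀ γ₁ : ℝ} (hγ₀ : 0 < γ₀) (hγ₁ : 0 ≤ γ₁)
    (hlo : ∀ v, γ₀ * ‖v‖ ^ 2 ≤ V'' δ₀ v v) (hhi : ∀ v, V'' δ₀ v v ≤ γ₁ * ‖v‖ ^ 2)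
    {N c : ℝ≥0} (hN : Real.sqrt (γ₁ / γ₀) + γ₀⁻¹ ≤ (N : ℝ)) (hc : c < N⁻¹)
    {r : ℝ} (hr : 0 ≤ r) (hV : ∀ x ∈ closedBall δ₀ r, HasFDerivAt (fderiv ℝ V) (V'' x) x)
    (hVc : ∀ x ∈ closedBall δ₀ r, ‖V'' x - V'' δ₀‖ ≤ c) (hcrit : ∀ k ∈ D.ker, fderiv ℝ V δ₀ k = 0) :
    ∃ σ : F → E, σ (D δ₀) = δ₀ ∧
      (∀ w ∈ closedBall (D δ₀) (((N : ℝ)⁻¹ - c) * r),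
        σ w ∈ closedBall δ₀ r ∧ D (σ w) = w ∧ ∀ k ∈ D.ker, fderiv ℝ V (σ w) k = 0) ∧
      LipschitzOnWith (N⁻¹ - c)⁻¹ σ (closedBall (D δ₀) (((N : ℝ)⁻¹ - c) * r)) ∧
      (∀ δ ∈ closedBall δ₀ r, (∀ k ∈ D.ker, fderiv ℝ V δ k = 0) → σ (D δ) = δ) := by
  obtain ⟨T, hT, hTN⟩ := ChartLetterSandwich.exists_augHessian_equiv_of_sandwich_iso_nnreal (Q := V'' δ₀) (D := D) S hS hSiso
    hsymm hγ₀ hγ₁ hlo hhi hN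
  exact HardStepChartRadius.exists_criticalBranch_chart_ker D T hT hr hTN hc hV hVc hcrit

/-- Real arithmetic: the energy-currency constant is positive. [folklore] -/
theorem sandwichConst_pos {γ₀ γ₁ : ℝ} (hγ₀ : 0 < γ₀) : 0 < Real.sqrt (γ₁ / γ₀) + γ₀⁻¹ :=
  add_pos_of_nonneg_of_pos (Real.sqrt_nonneg _) (inv_pos.mpr hγ₀)

/-- **THE SAME WITH THE SANDWICH CONSTANT ITSELF**: `N := (√(γ₁∕γ₀) + γ₀⁻¹).toNNReal`, smallness `c < (√(γ₁∕γ₀) + γ₀⁻¹)⁻¹` on the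
reals — radius `((√(γ₁∕γ₀) + γ₀⁻¹)⁻¹ − c)·r`, uniform in whatever the blocking `D` composes. [folklore] -/
theorem oneShotBranch_of_sandwich' (D : E →L[ℝ] F) {V : E → ℝ} {V'' : E → E →L[ℝ] E →L[ℝ] ℝ} {δ₀ : E}
    (S : F →L[ℝ] E) (hS : ∀ k, D (S k) = k) (hSiso : ∀ k, ‖S k‖ = ‖k‖)
    (hsymm : ∀ u v, V'' δ₀ u v = V'' δ₀ v u) {γ₀ γ₁ : ℝ} (hγ₀ : 0 < γ₀) (hγ₁ : 0 ≤ γ₁)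
    (hlo : ∀ v, γ₀ * ‖v‖ ^ 2 ≤ V'' δ₀ v v) (hhi : ∀ v, V'' δ₀ v v ≤ γ₁ * ‖v‖ ^ 2)
    {c : ℝ≥0} (hc : (c : ℝ) < (Real.sqrt (γ₁ / γ₀) + γ₀⁻¹)⁻¹)
    {r : ℝ} (hr : 0 ≤ r) (hV : ∀ x ∈ closedBall δ₀ r, HasFDerivAt (fderiv ℝ V) (V'' x) x)
    (hVc : ∀ x ∈ closedBall δ₀ r, ‖V'' x - V'' δ₀‖ ≤ c) (hcrit : ∀ k ∈ D.ker, fderiv ℝ V δ₀ k = 0) :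
    ∃ σ : F → E, σ (D δ₀) = δ₀ ∧
      (∀ w ∈ closedBall (D δ₀) (((Real.sqrt (γ₁ / γ₀) + γ₀⁻¹)⁻¹ - c) * r),
        σ w ∈ closedBall δ₀ r ∧ D (σ w) = w ∧ ∀ k ∈ D.ker, fderiv ℝ V (σ w) k = 0) ∧
      LipschitzOnWith ((Real.sqrt (γ₁ / γ₀) + γ₀⁻¹).toNNReal⁻¹ - c)⁻¹ σ
        (closedBall (D δ₀) (((Real.sqrt (γ₁ / γ₀) + γ₀⁻¹)⁻¹ - c) * r)) ∧
      (∀ δ ∈ closedBall δ₀ r, (∀ k ∈ D.ker, fderiv ℝ V δ k = 0) → σ (D δ) = δ) := by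
  have hpos := sandwichConst_pos (γ₁ := γ₁) hγ₀
  have hcoe : (((Real.sqrt (γ₁ / γ₀) + γ₀⁻¹).toNNReal : ℝ≥0) : ℝ) = Real.sqrt (γ₁ / γ₀) + γ₀⁻¹ :=
    Real.coe_toNNReal _ hpos.le
  have hN : Real.sqrt (γ₁ / γ₀) + γ₀⁻¹ ≤ (((Real.sqrt (γ₁ / γ₀) + γ₀⁻¹).toNNReal : ℝ≥0) : ℝ) := hcoe.ge
  have hc' : c < ((Real.sqrt (γ₁ / γ₀) + γ₀⁻¹).toNNReal)⁻¹ := by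
    rw [← NNReal.coe_lt_coe, NNReal.coe_inv, hcoe]; exact hc
  have h := oneShotBranch_of_sandwich D S hS hSiso hsymm hγ₀ hγ₁ hlo hhi hN hc' hr hV hVc hcrit
  rwa [hcoe] at h

/-! ## §2. Toy -/

/-- Toy (real arithmetic): at the Gaussian point `γ₀ = γ₁ = 1` the radius fraction with modulus `c = 1∕4` is `1∕2 − 1∕4 = 1∕4`. -/
example : (Real.sqrt ((1 : ℝ) / 1) + (1 : ℝ)⁻¹)⁻¹ - (1 / 4 : ℝ) = 1 / 4 := by norm_num

/-! ## §3 (v1.1, append-only). The SHARP one-shot constant `√(γ₁∕γ₀ + γ₀⁻²)` (CLSW v1.1 §5, Pythagoras for the two columns) -/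

/-- **THE ONE-SHOT CHART WITH THE SHARP CONSTANT**: as `oneShotBranch_of_sandwich` but with `√(γ₁∕γ₀ + γ₀⁻¹∕γ₀) ≤ N` (CLSW v1.1
`exists_augHessian_equiv_of_coercive_sharp` — the two columns of `T⁻¹` are `Q`-orthogonal, their energies add): `√2` instead of `2` at the
Gaussian point, so the radius fraction `N⁻¹ − c` starts from `1∕√2` there. [folklore] -/
theorem oneShotBranch_of_sandwich_sharp (D : E →L[ℝ] F) {V : E → ℝ} {V'' : E → E →L[ℝ] E →L[ℝ] ℝ} {δ₀ : E}
    (S : F →L[ℝ] E) (hS : ∀ k, D (S k) = k) (hSiso : ∀ k, ‖S k‖ = ‖k‖)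
    (hsymm : ∀ u v, V'' δ₀ u v = V'' δ₀ v u) {γ₀ γ₁ : ℝ} (hγ₀ : 0 < γ₀) (hγ₁ : 0 ≤ γ₁)
    (hlo : ∀ v, γ₀ * ‖v‖ ^ 2 ≤ V'' δ₀ v v) (hhi : ∀ v, V'' δ₀ v v ≤ γ₁ * ‖v‖ ^ 2)
    {N c : ℝ≥0} (hN : Real.sqrt (γ₁ / γ₀ + γ₀⁻¹ / γ₀) ≤ (N : ℝ)) (hc : c < N⁻¹)
    {r : ℝ} (hr : 0 ≤ r) (hV : ∀ x ∈ closedBall δ₀ r, HasFDerivAt (fderiv ℝ V) (V'' x) x)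
    (hVc : ∀ x ∈ closedBall δ₀ r, ‖V'' x - V'' δ₀‖ ≤ c) (hcrit : ∀ k ∈ D.ker, fderiv ℝ V δ₀ k = 0) :
    ∃ σ : F → E, σ (D δ₀) = δ₀ ∧
      (∀ w ∈ closedBall (D δ₀) (((N : ℝ)⁻¹ - c) * r),
        σ w ∈ closedBall δ₀ r ∧ D (σ w) = w ∧ ∀ k ∈ D.ker, fderiv ℝ V (σ w) k = 0) ∧
      LipschitzOnWith (N⁻¹ - c)⁻¹ σ (closedBall (D δ₀) (((N : ℝ)⁻¹ - c) * r)) ∧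
      (∀ δ ∈ closedBall δ₀ r, (∀ k ∈ D.ker, fderiv ℝ V δ k = 0) → σ (D δ) = δ) := by
  have hC : ∀ k, V'' δ₀ (S k) (S k) ≤ γ₁ * ‖k‖ ^ 2 := fun k => by rw [← hSiso k]; exact hhi (S k)
  obtain ⟨T, hT, hTN⟩ := ChartLetterSandwich.exists_augHessian_equiv_of_coercive_sharp (Q := V'' δ₀) (D := D) S hS hsymm hγ₀
    hlo hγ₁ hC hN
  exact HardStepChartRadius.exists_criticalBranch_chart_ker D T hT hr hTN hc hV hVc hcrit

/-- Toy: the sharp constant at the Gaussian point is `√2 < 2`. -/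
example : Real.sqrt ((1 : ℝ) / 1 + (1 : ℝ)⁻¹ / 1) < 2 := by
  rw [show (1 : ℝ) / 1 + (1 : ℝ)⁻¹ / 1 = 2 by norm_num]
  rw [Real.sqrt_lt' (by norm_num)]
  norm_num

end Summit.QuantumFields.BalabanUV.T4Continuum.NE7b.OneShotChartEnergy

end
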